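/-
Copyright (c) 2026 the pub-hodgecm-mathlib formalisation cell (harness21).  Prover seat hodgecm-mathlib-LH4-p08 (g2), req620 Track A «(D-RAM) FOUR-FRAME» squad, unit U3_Laws (iii),
MS ROAD STAGE B (Stage B lead LH4-p10 (g2), MS ledger LH4-p11 (g0); dealer LH4-plan (g11)): brick B5 (iv) «GLUED PARAMETER BOX COUNT» of `SPEC-StageB.v2-B5split.LH4p10g2.md`
(a6778cd80cb70dec), sub-brick (iv-a) «TORUS ORBITS OF THE GLUED STRATUM» (route LH4-p08 (g2) 2026-09-03T23:56Z).  2026-09-04.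
-/
import Summits.HodgeConjecture.HodgeConjecture.Theorems.F0P3cDyRamDiagonalStableLatticeHNFExists   -- ★ p855304 (LH4-p08 (g0)): `latt_hnf_eq_latt_hnf_iff`
import Summits.HodgeConjecture.HodgeConjecture.Theorems.F0P3cDyRamDiagonalTorusDefs               -- ★ (LH4-p11 (g0)): `unitTorus`, `diagGLUnits`, `latticeStabilizer`
import Summits.HodgeConjecture.HodgeConjecture.Theorems.F0P3cDyRamDiagonalGluedTubeCriterion      -- ★ p855737 B5 (i) (LH4-p10 (g2)): `isDualisableLattice_latt_hnf_glued_iff` (criterion (R))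
import HarnessLib

/-!
# Crux `H413`, line LH4 «(D-RAM) FOUR-FRAME» road — unit U3_Laws (iii), MS ROAD STAGE B, brick B5 (iv), sub-brick (iv-a): the UNIT-TORUS ORBITS of the GLUED stratum —
# `diag(u)` acts on the glued parameters by `(x, ζ, y″) ↦ (x·u₁∕u₀, ζ·u₂∕u₁, y″·u₂∕u₀)`, the invariant `κ = y″∕(xζ)` is a LATTICE invariant modulo `𝔭^{ρ+2t}`, and the lattices
# with `κ ≡ f` form the single orbit `𝒯 · latt V(1, 1, f)`

Cell `hodgecm-mathlib` (D-0151), FLOOR 0, crux item H413 = `stmt-HodgeConjecture-24833`, route of record `HCCMUnconditional`; squad F0∕P3c∕LH4 (req620).  THEOREMS ONLY (no `def`,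
no instance, no notation, no `sorry`, default heartbeats); lane `--supports stmt-HodgeConjecture-24833 --as helper` (count-neutral).  Second sub-brick of B5 (iv) (LH4-p10 (g2) SPEC
v2-B5split §B5(iv)) on the ORBIT–STABILISER route: with ★ (iv-b-mem) (stabiliser), (iv-b-idx) (its index), (iv-c) (the `F`-rational class count) it yields
`#{dualisable glued lattices} = #{F-rational classes} · [𝒯 : Stab]`.

GLUED DATA.  `V(x, ζ, y″) = [[1,0,0],[x, ϖ^ρ, 0],[xζ + y″, ϖ^ρ ζ, ϖ^{2ρ+2t}]]` (★ B5 (i) p855737's convention), `x, ζ` units, `|y″| = |ϖ|^{2t}`; `κ := y″∕(xζ)` (`|κ| = |ϖ|^{2t}`).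
WHAT IS PROVED (generic valued field `K`, `Valued K ℤᵐ⁰`, `ϖ ≠ 0`; no `σ`, no completeness):
* §1 `diagonal_mul_glued_eq` — the MATRIX identity `diag(u)·V(x, ζ, y″) = V(x u₁∕u₀, ζ u₂∕u₁, y″ u₂∕u₀)·diag(u)`; `latt_mul_diagonal_units` — `latt (A·diag(u)) = latt A` for unit `u`;
  **`mapGL_diagGLUnits_latt_glued`** — `diag(u)·latt V(x, ζ, y″) = latt V(x u₁∕u₀, ζ u₂∕u₁, y″ u₂∕u₀)` (so `κ` is EXACTLY `𝒯`-invariant and the glued shape is preserved).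
* §2 **`v_kappa_sub_le_of_latt_glued_eq`** — if `latt V(x, ζ, y″) = latt V(x′, ζ′, y‴)` (both glued) then `|y″∕(xζ) − y‴∕(x′ζ′)| ≤ |ϖ|^{ρ+2t}` (★ p855304 `latt_hnf_eq_latt_hnf_iff`: `x − x′ ∈ 𝔭^ρ`,
  `ζ − ζ′ ∈ 𝔭^{ρ+2t}`, `y″ − y‴ ≡ x(ζ − ζ′)` mod `𝔭^{2ρ+2t}`).
* §3 **`latt_glued_eq_latt_glued_rep`** — conversely, if `|κ − f| ≤ |ϖ|^{ρ+2t}` (`|f| < 1`) then `latt V(x, ζ, y″) = latt V(x, ζ′, f·x·ζ′)` with the unit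
  `ζ′ = ζ(1 + κ)∕(1 + f)` (same first column, `ζ − ζ′ = ζ(f − κ)∕(1 + f)`): every lattice of the class `κ ≡ f` has a representative with `κ = f` EXACTLY;
  **`latt_glued_kappa_eq_mapGL`** — `latt V(x, ζ, f x ζ) = diag(1, x, xζ)·latt V(1, 1, f)`; hence **`exists_mem_unitTorus_latt_glued_eq_mapGL`** — every glued lattice with
  `|κ − f| ≤ |ϖ|^{ρ+2t}` lies in the orbit `𝒯·latt V(1, 1, f)`, and **`exists_glued_of_mem_orbit`** — every member of that orbit is `latt V(x′, ζ′, y₁)` glued with `κ = f`.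
* §4 **`isDualisableLattice_latt_glued_iff_exists_fixed_kappa`** — ★ B5 (i)'s criterion (R) in `κ`-currency: `latt V(x, ζ, y″)` is dualisable iff `∃ f, σ f = f ∧ |κ − f| ≤ |ϖ|^{ρ+2t}`
  (the class of `κ` mod `𝔭^{ρ+2t}` is `F`-RATIONAL): `ζσ(y″) − σ(x)·f = σ(xζσζ)·σ(κ − f∕(ζσζ))` and `ζσζ` is a fixed unit.
HONEST LABEL.  Count-neutral; nothing printed is asserted; the census laws stay PROVER TARGETS; `HC_CM` is proved only modulo the 7 printed citations (2 remaining named inputs: hLiu418 =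
`stmt-HodgeConjecture-24832`, h413 = `stmt-HodgeConjecture-24833`) until rung 0 closes.

## References
* [Kottwitz1986BaseChangeUnits] R. Kottwitz, *Base change for unit elements of Hecke algebras*, Compositio Math. 60 (1986), §1 pp. 240–241 (lattice counts via torus orbits).
* [Serre1980Trees] J.-P. Serre, *Trees*, Springer (1980), Ch. II §1.1 (lattices `g·𝒪^N`, Hermite normal forms).
-/

set_option autoImplicit false

noncomputable section

namespace Summit.HodgeConjecture.HodgeConjecture.Cruxes.H413.F0P3cDyRamDiagonalGluedTorusOrbits

open Matrix
open Literature.NumberTheory.Automorphic Literature.NumberTheory.Automorphic.HermitianLattice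
open Literature.NumberTheory.Automorphic.UnitaryLatticeTree
open Summit.HodgeConjecture.HodgeConjecture.Cruxes.H413.F0P3cDyRamDiagonalTorusDefs
open Summit.HodgeConjecture.HodgeConjecture.Cruxes.H413.F0P3cDyRamDiagonalStableLatticeHNFExists (latt_hnf_eq_latt_hnf_iff)
open scoped Valued WithZero Matrix MatrixGroups

variable {K : Type*} [Field K] [Valued K ℤᵐ⁰]

/-! ## §1 The unit torus acts on the glued parameters -/

omit [Valued K ℤᵐ⁰] in
/-- **`diag(u)·V(x, ζ, y″) = V(x u₁∕u₀, ζ u₂∕u₁, y″ u₂∕u₀)·diag(u)`** (entrywise; `u_i ≠ 0`). [cite: Kottwitz1986BaseChangeUnits, §1 pp. 240–241] -/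
theorem diagonal_mul_glued_eq (u : Fin 3 → Kˣ) (x ζ y'' p r : K) :
    Matrix.diagonal (fun i => (u i : K)) * !![1, 0, 0; x, p, 0; x * ζ + y'', p * ζ, r] =
      !![1, 0, 0; x * ((u 1 : K) / u 0), p, 0; x * ((u 1 : K) / u 0) * (ζ * ((u 2 : K) / u 1)) + y'' * ((u 2 : K) / u 0), p * (ζ * ((u 2 : K) / u 1)), r] *
        Matrix.diagonal (fun i => (u i : K)) := by
  have h0 : (u 0 : K) ≠ 0 := (u 0).ne_zero
  have h1 : (u 1 : K) ≠ 0 := (u 1).ne_zero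
  ext i j
  fin_cases i <;> fin_cases j <;> simp [Matrix.mul_apply, Matrix.diagonal] <;> field_simp

/-- **`latt (A · diag(u)) = latt A`** for a unit diagonal `u` (`|u_i| = 1`): `diag(u)·𝒪^N = 𝒪^N`. [cite: Serre1980Trees, II §1.1] -/
theorem latt_mul_diagonal_units {N : ℕ} (A : Matrix (Fin N) (Fin N) K) (u : Fin N → Kˣ) (hu : ∀ i, Valued.v (u i : K) = 1) :
    latt (A * Matrix.diagonal (fun i => (u i : K))) = latt A := by
  have hD : IsUnit (Matrix.diagonal (fun i => (u i : K))).det := by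
    rw [Matrix.det_diagonal]
    exact IsUnit.mk0 _ (Finset.prod_ne_zero_iff.2 fun i _ => (u i).ne_zero)
  have hDlatt : latt (Matrix.diagonal (fun i => (u i : K))) = stdLattice K N := by
    apply le_antisymm
    · exact (latt_le_stdLattice_iff _).2 fun i j => by
        rw [Matrix.diagonal_apply]; split_ifs <;> simp [hu]
    · intro w hw
      have hw' : (fun i => w i / (u i : K)) ∈ stdLattice K N := by
        rw [mem_stdLattice] at hw ⊢
        intro i
        rw [map_div₀, hu, div_one]
        exact hw i
      have hmem := mulVec_mem_latt (Matrix.diagonal fun i => (u i : K)) hw'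
      have heq : (Matrix.diagonal fun i => (u i : K)).mulVec (fun i => w i / (u i : K)) = w := by
        funext i
        rw [Matrix.mulVec_diagonal, mul_div_cancel₀ _ (u i).ne_zero]
      rwa [heq] at hmem
  rw [latt_mul, hDlatt]
  rfl

omit [Valued K ℤᵐ⁰] in
/-- **A glued matrix is invertible** (`p, r ≠ 0`; determinant `p·r`): a `GL`-element with the glued entries exists. [cite: Serre1980Trees, II §1.1] -/
theorem exists_gl_coe_eq_glued (x ζ y'' : K) {p r : K} (hp : p ≠ 0) (hr : r ≠ 0) :
    ∃ V : GL (Fin 3) K, (V : Matrix (Fin 3) (Fin 3) K) = !![1, 0, 0; x, p, 0; x * ζ + y'', p * ζ, r] := by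
  have hdet : (!![1, 0, 0; x, p, 0; x * ζ + y'', p * ζ, r] : Matrix (Fin 3) (Fin 3) K).det ≠ 0 := by
    rw [Matrix.det_fin_three]; simp [hp, hr]
  exact ⟨Matrix.GeneralLinearGroup.mkOfDetNeZero _ hdet, rfl⟩

/-- **THE TORUS MOVES THE GLUED PARAMETERS**: for a unit diagonal `u ∈ 𝒯`, `diag(u)·latt V(x, ζ, y″) = latt V(x u₁∕u₀, ζ u₂∕u₁, y″ u₂∕u₀)` (same `p = ϖ^ρ`, `r = ϖ^{2ρ+2t}`) —
so the glued shape is preserved, `x, ζ` stay units, `|y″|` is unchanged, and `κ = y″∕(xζ)` is EXACTLY invariant. [cite: Kottwitz1986BaseChangeUnits, §1 pp. 240–241] -/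
theorem mapGL_diagGLUnits_latt_glued (u : Fin 3 → Kˣ) (hu : u ∈ unitTorus K 3) (x ζ y'' p r : K) (V : GL (Fin 3) K)
    (hV : (V : Matrix (Fin 3) (Fin 3) K) = !![1, 0, 0; x, p, 0; x * ζ + y'', p * ζ, r]) :
    mapGL (diagGLUnits u) (latt (V : Matrix (Fin 3) (Fin 3) K)) =
      latt (!![1, 0, 0; x * ((u 1 : K) / u 0), p, 0; x * ((u 1 : K) / u 0) * (ζ * ((u 2 : K) / u 1)) + y'' * ((u 2 : K) / u 0), p * (ζ * ((u 2 : K) / u 1)), r] :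
        Matrix (Fin 3) (Fin 3) K) := by
  rw [mem_unitTorus_iff] at hu
  rw [mapGL_latt, Units.val_mul, coe_diagGLUnits, hV, diagonal_mul_glued_eq, latt_mul_diagonal_units _ u hu]

/-! ## §2 The invariant `κ = y″∕(xζ)` modulo `𝔭^{ρ+2t}` -/

/-- **`κ` IS A LATTICE INVARIANT modulo `𝔭^{ρ+2t}`**: if two glued data `(x, ζ, y″)`, `(x₁, ζ₁, y₁)` give the same lattice, `|y″∕(xζ) − y₁∕(x₁ζ₁)| ≤ |ϖ|^{ρ+2t}`.  By ★ p855304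
`latt_hnf_eq_latt_hnf_iff`: `a := x − x₁ ∈ 𝔭^ρ`, `c := ζ − ζ₁ ∈ 𝔭^{ρ+2t}`, `E := y″ − y₁ + x c ∈ 𝔭^{2ρ+2t}`, and `y″x₁ζ₁ − y₁xζ = y″(−xc − aζ + ac) − x²ζc + E·xζ`, each term in `𝔭^{ρ+2t}`
(`|y″| = |ϖ|^{2t}`). [cite: Kottwitz1986BaseChangeUnits, §1 pp. 240–241] [cite: Serre1980Trees, II §1.1] -/
theorem v_kappa_sub_le_of_latt_glued_eq {ϖ : K} (hϖ : ϖ ≠ 0) (hϖ1 : Valued.v ϖ ≤ 1) (ρ t : ℕ) {x ζ y'' x₁ ζ₁ y₁ : K}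
    (hx : Valued.v x = 1) (hζ : Valued.v ζ = 1) (hy'' : Valued.v y'' = Valued.v ϖ ^ (2 * t)) (hx₁ : Valued.v x₁ = 1) (hζ₁ : Valued.v ζ₁ = 1)
    (h : latt (!![1, 0, 0; x, ϖ ^ ρ, 0; x * ζ + y'', ϖ ^ ρ * ζ, ϖ ^ (2 * ρ + 2 * t)] : Matrix (Fin 3) (Fin 3) K) =
      latt (!![1, 0, 0; x₁, ϖ ^ ρ, 0; x₁ * ζ₁ + y₁, ϖ ^ ρ * ζ₁, ϖ ^ (2 * ρ + 2 * t)] : Matrix (Fin 3) (Fin 3) K)) :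
    Valued.v (y'' / (x * ζ) - y₁ / (x₁ * ζ₁)) ≤ Valued.v ϖ ^ (ρ + 2 * t) := by
  have hpρ : ϖ ^ ρ ≠ 0 := pow_ne_zero ρ hϖ
  have hpr : ϖ ^ (2 * ρ + 2 * t) ≠ 0 := pow_ne_zero _ hϖ
  have hvρ : (0 : ℤᵐ⁰) < Valued.v ϖ ^ ρ := pow_pos ((Valuation.pos_iff _).2 hϖ) ρ
  obtain ⟨ha, hc, he⟩ := (latt_hnf_eq_latt_hnf_iff x (x * ζ + y'') (ϖ ^ ρ * ζ) x₁ (x₁ * ζ₁ + y₁) (ϖ ^ ρ * ζ₁) hpρ hpr).1 h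
  rw [map_pow] at ha
  -- `|ζ − ζ₁| ≤ |ϖ|^(ρ + 2t)`
  have hc' : Valued.v (ζ - ζ₁) ≤ Valued.v ϖ ^ (ρ + 2 * t) := by
    rw [← mul_sub, map_mul, map_pow, map_pow, show 2 * ρ + 2 * t = ρ + (ρ + 2 * t) by ring, pow_add] at hc
    exact (mul_le_mul_iff_right₀ hvρ).1 hc
  -- `|E| ≤ |ϖ|^(2ρ + 2t)`, `E = y″ − y₁ + x(ζ − ζ₁)`
  have he' : Valued.v (y'' - y₁ + x * (ζ - ζ₁)) ≤ Valued.v ϖ ^ (2 * ρ + 2 * t) := by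
    have hE : (x * ζ + y'' - (x₁ * ζ₁ + y₁)) * ϖ ^ ρ - ϖ ^ ρ * ζ₁ * (x - x₁) = ϖ ^ ρ * (y'' - y₁ + x * (ζ - ζ₁)) := by ring
    rw [hE, map_mul, map_mul, map_pow, map_pow] at he
    exact (mul_le_mul_iff_right₀ hvρ).1 he
  -- the difference of the two `κ`'s
  have hx0 : x ≠ 0 := fun h0 => by rw [h0, map_zero] at hx; exact zero_ne_one hx
  have hζ0 : ζ ≠ 0 := fun h0 => by rw [h0, map_zero] at hζ; exact zero_ne_one hζ
  have hx0' : x₁ ≠ 0 := fun h0 => by rw [h0, map_zero] at hx₁; exact zero_ne_one hx₁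
  have hζ0' : ζ₁ ≠ 0 := fun h0 => by rw [h0, map_zero] at hζ₁; exact zero_ne_one hζ₁
  have key : y'' / (x * ζ) - y₁ / (x₁ * ζ₁) =
      (y'' * (-(x * (ζ - ζ₁)) - (x - x₁) * ζ + (x - x₁) * (ζ - ζ₁)) - x * x * ζ * (ζ - ζ₁) + (y'' - y₁ + x * (ζ - ζ₁)) * (x * ζ)) / (x * ζ * (x₁ * ζ₁)) := by
    rw [div_sub_div _ _ (mul_ne_zero hx0 hζ0) (mul_ne_zero hx0' hζ0')]
    congr 1
    ring
  have hden : Valued.v (x * ζ * (x₁ * ζ₁)) = 1 := by rw [map_mul, map_mul, map_mul, hx, hζ, hx₁, hζ₁]; simp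
  rw [key, map_div₀, hden, div_one]
  have hρle : Valued.v ϖ ^ (ρ + 2 * t) ≤ Valued.v ϖ ^ ρ := by
    rw [pow_add]; exact mul_le_of_le_one_right' (pow_le_one₀ zero_le hϖ1)
  refine Valuation.map_add_le _ (Valuation.map_sub_le _ ?_ ?_) ?_
  · -- `y″·(−xc − aζ + ac)`
    rw [map_mul, hy'', show ρ + 2 * t = 2 * t + ρ by ring, pow_add]
    refine mul_le_mul' le_rfl (Valuation.map_add_le _ (Valuation.map_sub_le _ ?_ ?_) ?_)
    · rw [Valuation.map_neg, map_mul, hx, one_mul]; exact hc'.trans hρle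
    · rw [map_mul, hζ, mul_one]; exact ha
    · rw [map_mul]; exact le_trans (mul_le_of_le_one_right' (hc'.trans (pow_le_one₀ zero_le hϖ1))) ha
  · -- `x²ζ·c`
    simpa [map_mul, hx, hζ] using hc'
  · -- `E·xζ`
    rw [map_mul, map_mul, hx, hζ, mul_one, mul_one]
    refine he'.trans ?_
    rw [show 2 * ρ + 2 * t = ρ + (ρ + 2 * t) by ring, pow_add]
    exact mul_le_of_le_one_left' (pow_le_one₀ zero_le hϖ1)

/-! ## §3 Representatives with `κ = f` exactly; the orbit of `latt V(1, 1, f)` -/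

/-- **EVERY CLASS `κ ≡ f (mod 𝔭^{ρ+2t})` HAS A REPRESENTATIVE WITH `κ = f`.**  For glued `(x, ζ, y″)` and `f` with `|f| < 1`, `|y″∕(xζ) − f| ≤ |ϖ|^{ρ+2t}`, put
`ζ′ := ζ·(1 + y″∕(xζ))∕(1 + f)` (a unit: `ζ − ζ′ = ζ(f − κ)∕(1 + f)`); then `latt V(x, ζ, y″) = latt V(x, ζ′, f·(xζ′))` — same first column `xζ′(1+f) = xζ + y″`, `ϖ^ρ(ζ − ζ′) ∈ 𝔭^{2ρ+2t}`
(★ p855304 `latt_hnf_eq_latt_hnf_iff`). [cite: Kottwitz1986BaseChangeUnits, §1 pp. 240–241] [cite: Serre1980Trees, II §1.1] -/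
theorem latt_glued_eq_latt_glued_rep {ϖ : K} (hϖ : ϖ ≠ 0) (ρ t : ℕ) {x ζ y'' f : K} (hx : Valued.v x = 1) (hζ : Valued.v ζ = 1) (hf : Valued.v f < 1)
    (hκ : Valued.v (y'' / (x * ζ) - f) ≤ Valued.v ϖ ^ (ρ + 2 * t)) :
    latt (!![1, 0, 0; x, ϖ ^ ρ, 0; x * ζ + y'', ϖ ^ ρ * ζ, ϖ ^ (2 * ρ + 2 * t)] : Matrix (Fin 3) (Fin 3) K) =
      latt (!![1, 0, 0; x, ϖ ^ ρ, 0; x * (ζ * (1 + y'' / (x * ζ)) / (1 + f)) + f * (x * (ζ * (1 + y'' / (x * ζ)) / (1 + f))),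
        ϖ ^ ρ * (ζ * (1 + y'' / (x * ζ)) / (1 + f)), ϖ ^ (2 * ρ + 2 * t)] : Matrix (Fin 3) (Fin 3) K) := by
  have hpρ : ϖ ^ ρ ≠ 0 := pow_ne_zero ρ hϖ
  have hpr : ϖ ^ (2 * ρ + 2 * t) ≠ 0 := pow_ne_zero _ hϖ
  have hx0 : x ≠ 0 := fun h0 => by rw [h0, map_zero] at hx; exact zero_ne_one hx
  have hζ0 : ζ ≠ 0 := fun h0 => by rw [h0, map_zero] at hζ; exact zero_ne_one hζ
  have h1f : Valued.v (1 + f) = 1 := Valued.v.map_one_add_of_lt hf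
  have h1f0 : 1 + f ≠ 0 := fun h0 => by rw [h0, map_zero] at h1f; exact zero_ne_one h1f
  rw [latt_hnf_eq_latt_hnf_iff _ _ _ _ _ _ hpρ hpr]
  refine ⟨by rw [sub_self, map_zero]; exact zero_le, ?_, ?_⟩
  · -- `ϖ^ρ(ζ − ζ′)`, `ζ − ζ′ = ζ(f − κ)∕(1 + f)`
    have hdiff : ϖ ^ ρ * ζ - ϖ ^ ρ * (ζ * (1 + y'' / (x * ζ)) / (1 + f)) = ϖ ^ ρ * (ζ * (f - y'' / (x * ζ)) / (1 + f)) := by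
      field_simp
      ring
    rw [hdiff, map_mul, map_div₀, map_mul, h1f, div_one, map_pow, map_pow, hζ, one_mul, Valuation.map_sub_swap,
      show 2 * ρ + 2 * t = ρ + (ρ + 2 * t) by ring, pow_add]
    exact mul_le_mul' le_rfl hκ
  · -- the first columns agree: `xζ′(1 + f) = xζ + y″`
    have hcol : x * ζ + y'' - (x * (ζ * (1 + y'' / (x * ζ)) / (1 + f)) + f * (x * (ζ * (1 + y'' / (x * ζ)) / (1 + f)))) = 0 := by
      field_simp
      ring
    rw [hcol, sub_self, zero_mul, mul_zero, sub_zero, map_zero]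
    exact zero_le

/-- **THE LATTICES WITH `κ = f` EXACTLY are the `𝒯`-translates of `latt V(1, 1, f)`**: `latt V(x, ζ, f·xζ) = diag(1, x, xζ)·latt V(1, 1, f)` (`x, ζ` units).
[cite: Kottwitz1986BaseChangeUnits, §1 pp. 240–241] -/
theorem latt_glued_kappa_eq_mapGL {x ζ : K} (hx : Valued.v x = 1) (hζ : Valued.v ζ = 1) (f p r : K) (V₀ : GL (Fin 3) K)
    (hV₀ : (V₀ : Matrix (Fin 3) (Fin 3) K) = !![1, 0, 0; 1, p, 0; 1 * 1 + f, p * 1, r]) :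
    ∃ u ∈ unitTorus K 3,
      latt (!![1, 0, 0; x, p, 0; x * ζ + f * (x * ζ), p * ζ, r] : Matrix (Fin 3) (Fin 3) K) = mapGL (diagGLUnits u) (latt (V₀ : Matrix (Fin 3) (Fin 3) K)) := by
  have hx0 : x ≠ 0 := fun h0 => by rw [h0, map_zero] at hx; exact zero_ne_one hx
  have hζ0 : ζ ≠ 0 := fun h0 => by rw [h0, map_zero] at hζ; exact zero_ne_one hζ
  refine ⟨![1, Units.mk0 x hx0, Units.mk0 (x * ζ) (mul_ne_zero hx0 hζ0)], ?_, ?_⟩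
  · rw [mem_unitTorus_iff]
    intro i
    fin_cases i <;> simp [hx, hζ]
  · rw [mapGL_diagGLUnits_latt_glued _ (by rw [mem_unitTorus_iff]; intro i; fin_cases i <;> simp [hx, hζ]) 1 1 f p r V₀ hV₀]
    congr 1
    ext i j
    fin_cases i <;> fin_cases j <;> simp [mul_div_cancel_left₀ _ hx0]

/-- **EVERY GLUED LATTICE OF THE CLASS `κ ≡ f` LIES IN THE ORBIT `𝒯·latt V(1, 1, f)`** (`|f| < 1`; combine the two previous lemmas; `ζ′` is a unit).
[cite: Kottwitz1986BaseChangeUnits, §1 pp. 240–241] [cite: Serre1980Trees, II §1.1] -/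
theorem exists_mem_unitTorus_latt_glued_eq_mapGL {ϖ : K} (hϖ : ϖ ≠ 0) (ρ t : ℕ) {x ζ y'' f : K} (hx : Valued.v x = 1) (hζ : Valued.v ζ = 1)
    (hy'' : Valued.v y'' = Valued.v ϖ ^ (2 * t)) (ht : 1 ≤ t) (hϖ1 : Valued.v ϖ < 1) (hf : Valued.v f < 1)
    (hκ : Valued.v (y'' / (x * ζ) - f) ≤ Valued.v ϖ ^ (ρ + 2 * t)) (V₀ : GL (Fin 3) K)
    (hV₀ : (V₀ : Matrix (Fin 3) (Fin 3) K) = !![1, 0, 0; 1, ϖ ^ ρ, 0; 1 * 1 + f, ϖ ^ ρ * 1, ϖ ^ (2 * ρ + 2 * t)]) :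
    ∃ u ∈ unitTorus K 3,
      latt (!![1, 0, 0; x, ϖ ^ ρ, 0; x * ζ + y'', ϖ ^ ρ * ζ, ϖ ^ (2 * ρ + 2 * t)] : Matrix (Fin 3) (Fin 3) K) = mapGL (diagGLUnits u) (latt (V₀ : Matrix (Fin 3) (Fin 3) K)) := by
  -- `ζ′` is a unit: `|1 + κ| = |1 + f| = 1`
  have hx0 : x ≠ 0 := fun h0 => by rw [h0, map_zero] at hx; exact zero_ne_one hx
  have hζ0 : ζ ≠ 0 := fun h0 => by rw [h0, map_zero] at hζ; exact zero_ne_one hζ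
  have hκv : Valued.v (y'' / (x * ζ)) < 1 := by
    rw [map_div₀, map_mul, hx, hζ, mul_one, div_one, hy'']
    exact pow_lt_one₀ zero_le hϖ1 (by omega)
  have h1κ : Valued.v (1 + y'' / (x * ζ)) = 1 := Valued.v.map_one_add_of_lt hκv
  have h1f : Valued.v (1 + f) = 1 := Valued.v.map_one_add_of_lt hf
  have hζ' : Valued.v (ζ * (1 + y'' / (x * ζ)) / (1 + f)) = 1 := by rw [map_div₀, map_mul, hζ, h1κ, h1f, one_mul, div_one]
  obtain ⟨u, hu, h⟩ := latt_glued_kappa_eq_mapGL hx hζ' f (ϖ ^ ρ) (ϖ ^ (2 * ρ + 2 * t)) V₀ hV₀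
  exact ⟨u, hu, (latt_glued_eq_latt_glued_rep hϖ ρ t hx hζ hf hκ).trans h⟩

/-- **CONVERSELY every member of the orbit `𝒯·latt V(1, 1, f)` is a glued lattice with `κ = f` EXACTLY**: `diag(u)·latt V(1, 1, f) = latt V(x′, ζ′, y₁)` with the units
`x′ = u₁∕u₀`, `ζ′ = u₂∕u₁` and `y₁ = f·u₂∕u₀`, `y₁∕(x′ζ′) = f`. [cite: Kottwitz1986BaseChangeUnits, §1 pp. 240–241] -/
theorem exists_glued_of_mem_orbit (u : Fin 3 → Kˣ) (hu : u ∈ unitTorus K 3) (f p r : K) (V₀ : GL (Fin 3) K)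
    (hV₀ : (V₀ : Matrix (Fin 3) (Fin 3) K) = !![1, 0, 0; 1, p, 0; 1 * 1 + f, p * 1, r]) :
    ∃ x' ζ' y₁ : K, Valued.v x' = 1 ∧ Valued.v ζ' = 1 ∧ Valued.v y₁ = Valued.v f ∧ y₁ / (x' * ζ') = f ∧
      mapGL (diagGLUnits u) (latt (V₀ : Matrix (Fin 3) (Fin 3) K)) = latt (!![1, 0, 0; x', p, 0; x' * ζ' + y₁, p * ζ', r] : Matrix (Fin 3) (Fin 3) K) := by
  have hu' := (mem_unitTorus_iff u).1 hu
  have h0 : (u 0 : K) ≠ 0 := (u 0).ne_zero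
  have h1 : (u 1 : K) ≠ 0 := (u 1).ne_zero
  have h2 : (u 2 : K) ≠ 0 := (u 2).ne_zero
  refine ⟨(u 1 : K) / u 0, (u 2 : K) / u 1, f * ((u 2 : K) / u 0), by rw [map_div₀, hu', hu', div_one], by rw [map_div₀, hu', hu', div_one],
    by rw [map_mul, map_div₀, hu', hu', div_one, mul_one], by field_simp, ?_⟩
  rw [mapGL_diagGLUnits_latt_glued u hu 1 1 f p r V₀ hV₀]
  congr 1
  ext i j
  fin_cases i <;> fin_cases j <;> simp

/-! ## §4 Dualisability = `F`-rationality of the class of `κ` -/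

/-- **(R) IN `κ`-CURRENCY**: under the hypotheses of ★ B5 (i) `isDualisableLattice_latt_hnf_glued_iff` (involution `σ` with `v ∘ σ = v`, the wild trace bound, `ρ, t ≥ 1`), the glued
lattice `latt V(x, ζ, y″)` is DUALISABLE iff the class of `κ = y″∕(xζ)` modulo `𝔭^{ρ+2t}` contains a `σ`-fixed element: `∃ f, σ f = f ∧ |κ − f| ≤ |ϖ|^{ρ+2t}`.  (From (R)'s `f`:
`f′ := f∕(ζσζ)`; conversely `f := f′·ζσζ`; `|ζσ(y″) − σ(x) f′ζσζ| = |y″ − xζ f′|` by `v ∘ σ = v`.) [cite: Jacobowitz1962, §7] [cite: Kottwitz1986BaseChangeUnits, §1 pp. 240–241] -/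
theorem isDualisableLattice_latt_glued_iff_exists_fixed_kappa {σ : K →+* K} (hσ : ∀ a, σ (σ a) = a) (hvσ : ∀ a, Valued.v (σ a) = Valued.v a)
    {ϖ : K} (hϖ0 : ϖ ≠ 0) (hϖ1 : Valued.v ϖ < 1) (hTr : ∀ a : K, Valued.v (a + σ a) ≤ Valued.v ϖ * Valued.v a)
    (ρ t : ℕ) (hρ : 1 ≤ ρ) (ht : 1 ≤ t) {x ζ y'' : K} (hx : Valued.v x = 1) (hζ : Valued.v ζ = 1) (hy'' : Valued.v y'' = Valued.v ϖ ^ (2 * t))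
    (V : GL (Fin 3) K) (hV : (V : Matrix (Fin 3) (Fin 3) K) = !![1, 0, 0; x, ϖ ^ ρ, 0; x * ζ + y'', ϖ ^ ρ * ζ, ϖ ^ (2 * ρ + 2 * t)]) :
    IsDualisableLattice σ ϖ (latt (V : Matrix (Fin 3) (Fin 3) K)) ↔ ∃ f : K, σ f = f ∧ Valued.v (y'' / (x * ζ) - f) ≤ Valued.v ϖ ^ (ρ + 2 * t) := by
  rw [F0P3cDyRamDiagonalGluedTubeCriterion.isDualisableLattice_latt_hnf_glued_iff hσ hvσ hϖ0 hϖ1 hTr ρ t hρ ht hx hζ hy'' V hV]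
  have hx0 : x ≠ 0 := fun h0 => by rw [h0, map_zero] at hx; exact zero_ne_one hx
  have hζ0 : ζ ≠ 0 := fun h0 => by rw [h0, map_zero] at hζ; exact zero_ne_one hζ
  have hσζ0 : σ ζ ≠ 0 := fun h0 => hζ0 (by rw [← hσ ζ, h0, map_zero])
  have hσx : Valued.v (σ x) = 1 := by rw [hvσ, hx]
  have hσζ : Valued.v (σ ζ) = 1 := by rw [hvσ, hζ]
  have hN : σ (ζ * σ ζ) = ζ * σ ζ := by rw [map_mul, hσ, mul_comm]
  constructor
  · rintro ⟨f, hf, hR⟩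
    refine ⟨f / (ζ * σ ζ), by rw [map_div₀, hf, hN], ?_⟩
    -- `κ − f∕(ζσζ) = σ(ζσy″ − σx·f) ∕ (x ζ σζ)`
    have hid : y'' / (x * ζ) - f / (ζ * σ ζ) = σ (ζ * σ y'' - σ x * f) / (x * ζ * σ ζ) := by
      rw [map_sub, map_mul, map_mul, hσ, hσ, hf]
      field_simp
    rw [hid, map_div₀, hvσ, map_mul, map_mul, hx, hζ, hσζ, one_mul, one_mul, div_one]
    exact hR
  · rintro ⟨f, hf, hκ⟩
    refine ⟨f * (ζ * σ ζ), by rw [map_mul, hf, hN], ?_⟩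
    -- `ζσy″ − σx·(f ζσζ) = σ(xζσζ·(κ − f))`
    have hid : ζ * σ y'' - σ x * (f * (ζ * σ ζ)) = σ (x * ζ * σ ζ * (y'' / (x * ζ) - f)) := by
      rw [map_mul, map_sub, map_mul, map_mul, hσ, hf, map_div₀, map_mul]
      have hσx0 : σ x ≠ 0 := fun h0 => hx0 (by rw [← hσ x, h0, map_zero])
      field_simp
    rw [hid, hvσ, map_mul, map_mul, map_mul, hx, hζ, hσζ, one_mul, one_mul, one_mul]
    exact hκ

end Summit.HodgeConjecture.HodgeConjecture.Cruxes.H413.F0P3cDyRamDiagonalGluedTorusOrbits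

end
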